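import Literature.AnabelianGeometry.EtaleTheta.ThetaCoversAutCu
import Literature.AlgebraicGeometry.Frobenioids.Categories
import Mathlib.GroupTheory.IndexNormal
import HarnessLib

/-!
# [EtTh] Prop. 2.4 / 2.6 (characteristic nature of coverings): the uniqueness half discharged

Mochizuki, *The étale theta function and its Frobenioid-theoretic manifestations*, Publ. RIMS **45**
(2009), §2, Prop. 2.4 (PRIMS PDF pp. 38–39, printed 264–265) and Prop. 2.6 (p. 40)
[cite: MochizukiEtTh2009, Prop 2.4 p.38].

Cell abc-iut, layer L2, discharge item EtTh:Prop2.4 (seat abc-iut-L2-t7). Seat abc-iut-L2-t2 typed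
Prop. 2.4 / 2.6 over the interface `ThetaCovers.TemperedCoverData l` (`ThetaCoversTempered.lean`) as
the named facts `Prop24` / `Prop26`: every automorphism `γ` of the topological group `Π^tp_Z` of a
member `Z` of the tower of §2 extends to an automorphism of `Π^tp_C` stabilising the printed list of
`Π^tp`'s (`ExtendsStabilising … := ∃ Γ, …`, existence only, as printed: "induces isomorphisms").
The printed proof (p. 39) has two ingredients of different nature:
* EXISTENCE of the extension (the named facts `Prop24`/`Prop26` themselves) — "the hyperbolic
  curve determined by `X̲̲^log` admits a `K`-core" ([Mzk3] Thm. 2.4), [Mzk2] Lem. 1.3.8, "preserves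
  the decomposition groups of cusps" ([Mzk14] Thm. 6.5 (iii)), Thm. 1.6 (i) and Prop. 2.2 — absolute
  anabelian geometry, NOT available in the tree and not discharged here;
* UNIQUENESS / canonicity of the extension ("induces") — PROVED here from temp-slimness of `Π^tp_C`
  ([SemiAnbd] Ex. 3.10: "`Π` is temp-slim", i.e. the tree's `IsSlimGroup`: centralisers of open
  subgroups are trivial): `IsSlimGroup.apply_eq_self_of_eqOn` — an endomorphism of a slim topological
  group that fixes an open subgroup pointwise is the identity (for `n ∈ H ∩ g⁻¹Hg` one gets that
  `ψ(g)⁻¹g` centralises the open subgroup `H ∩ g⁻¹Hg`), hence two extensions of the same `γ`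
  coincide (`IsSlimGroup.continuousMulEquiv_eq_of_eqOn`, `extendsStabilising_unique`,
  `existsUnique_of_extendsStabilising`: under slimness `ExtendsStabilising` upgrades to `∃!`).
  `TemperedCoverData` does not carry temp-slimness (it is a field of the group-level interface
  `SemiGraphs.TemperedArithmeticGroup`), so it enters as an explicit hypothesis; reported to the
  interface owner.
* PART OF THE STABILISATION is group theory: the `X`-clause of Prop. 2.4 (i)/(ii) — an automorphism of
  `Π^tp_C` stabilising `Π^tp_{X̲̲}` (resp. `Π^tp_{X̲}`) stabilises `Π^tp_X`, since `Π^tp_X` is the unique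
  index-`2` subgroup containing it when `4 ∤ [Π_C : Π_{X̲̲}] = 2l²` (`map_tp_PiX_eq_of_PiXuu/_of_PiXu`,
  via `Subgroup.eq_of_index_two_of_le` and the tempered/profinite index bookkeeping
  `Subgroup.index_comap_of_denseRange`).
The tower members are open in `Π^tp_C` (`isOpen_tp`, from the interface field "`Π_{C̲̲}` open in `Π_C`").
Nothing here asserts that a `TemperedCoverData` exists; typed ≠ endorsed; no side is taken on any
disputed claim.
-/

namespace Literature.AnabelianGeometry.EtaleTheta

open Literature.AlgebraicGeometry.Frobenioids (IsSlimGroup)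

/-! ### Slim topological groups: automorphisms are determined on open subgroups -/

section Slim

variable {G : Type*} [Group G] [TopologicalSpace G] [IsTopologicalGroup G]

/-- In a slim topological group (centralisers of open subgroups are trivial, [SemiAnbd] §3 /
[FrdI] §0 "slim"), an endomorphism `ψ` fixing an open subgroup `H` pointwise is the identity: for
`n ∈ H ∩ g⁻¹Hg` one has `ψ(gng⁻¹) = gng⁻¹` and `= ψ(g) n ψ(g)⁻¹`, so `ψ(g)⁻¹ g` centralises the open
subgroup `H ∩ g⁻¹Hg`. This is the uniqueness mechanism of [EtTh] Prop. 2.4 / 2.6 ("induces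
isomorphisms" — uniquely). Dot-notation extension of the tree's `Frobenioids.IsSlimGroup`, declared
with its absolute name. [cite: MochizukiEtTh2009, Prop 2.4 p.38] -/
theorem _root_.Literature.AlgebraicGeometry.Frobenioids.IsSlimGroup.apply_eq_self_of_eqOn
    (hG : IsSlimGroup G) {H : Subgroup G}
    (hH : IsOpen (H : Set G)) (ψ : G →* G) (h : ∀ x ∈ H, ψ x = x) (g : G) : ψ g = g := by
  -- the open subgroup `K = H ∩ g⁻¹ H g = {n ∈ H | g n g⁻¹ ∈ H}`
  let K : Subgroup G := H ⊓ H.comap (MulAut.conj g).toMonoidHom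
  have hK : IsOpen (K : Set G) := by
    change IsOpen ((H : Set G) ∩ (fun n => (MulAut.conj g).toMonoidHom n) ⁻¹' (H : Set G))
    refine hH.inter (hH.preimage ?_)
    change Continuous fun n : G => g * n * g⁻¹
    fun_prop
  have hc : (ψ g)⁻¹ * g ∈ Subgroup.centralizer (K : Set G) := by
    rw [Subgroup.mem_centralizer_iff]
    rintro n ⟨hnH, hgn⟩
    have hgn' : g * n * g⁻¹ ∈ H := hgn
    have e1 : ψ (g * n * g⁻¹) = g * n * g⁻¹ := h _ hgn'
    rw [map_mul, map_mul, map_inv, h n hnH] at e1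
    -- `e1 : ψ g * n * (ψ g)⁻¹ = g * n * g⁻¹`
    calc n * ((ψ g)⁻¹ * g) = (ψ g)⁻¹ * (ψ g * n * (ψ g)⁻¹) * g := by group
      _ = (ψ g)⁻¹ * (g * n * g⁻¹) * g := by rw [e1]
      _ = (ψ g)⁻¹ * g * n := by group
  rw [hG.centralizer_eq_bot K hK, Subgroup.mem_bot] at hc
  -- `(ψ g)⁻¹ * g = 1`
  exact eq_of_inv_mul_eq_one hc

/-- Two continuous automorphisms of a slim topological group that agree on an open subgroup are
equal ([EtTh] Prop. 2.4: the extension of `γ` to `Π^tp_C` is unique because `Π^tp_C` is temp-slim).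
[cite: MochizukiEtTh2009, Prop 2.4 p.38] -/
theorem _root_.Literature.AlgebraicGeometry.Frobenioids.IsSlimGroup.continuousMulEquiv_eq_of_eqOn
    (hG : IsSlimGroup G) {H : Subgroup G}
    (hH : IsOpen (H : Set G)) (Γ Γ' : G ≃ₜ* G) (h : ∀ x ∈ H, Γ x = Γ' x) : Γ = Γ' := by
  have key : ∀ g, (Γ'.symm.toMulEquiv.toMonoidHom.comp Γ.toMulEquiv.toMonoidHom) g = g := by
    refine hG.apply_eq_self_of_eqOn hH _ fun x hx => ?_
    change Γ'.symm (Γ x) = x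
    rw [h x hx]
    exact Γ'.symm_apply_apply x
  ext g
  have := key g
  change Γ'.symm (Γ g) = g at this
  simpa using congrArg Γ' this

end Slim


/-! ### Index bookkeeping: dense maps, and the unique index-`2` overgroup -/

section Index

variable {G : Type*} [Group G]

/-- Along a homomorphism `f : Π → Π̂` with dense range, the pull-back of an OPEN subgroup `H` has the
same index: `[Π : f⁻¹H] = [Π̂ : H]` (every coset `xH` is open, hence meets the image of `f`). This is
the tempered/profinite index bookkeeping of [EtTh] §1–§2 ("`Π^tp ↪ Π̂`", p. 38; e.g. `[Π_C : Π_X] =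
[Π^tp_C : Π^tp_X] = 2`). [cite: MochizukiEtTh2009, Prop 2.4 p.38] -/
theorem _root_.Subgroup.index_comap_of_denseRange {P : Type*} [Group P] [TopologicalSpace P]
    [ContinuousMul P] (f : G →* P) (hf : DenseRange f) (H : Subgroup P)
    (hH : IsOpen (H : Set P)) : (H.comap f).index = H.index := by
  classical
  -- the induced map on left-coset spaces
  let φ : G ⧸ H.comap f → P ⧸ H := Quotient.map' f fun a b h => by
    rw [QuotientGroup.leftRel_apply] at h ⊢
    rw [Subgroup.mem_comap, map_mul, map_inv] at h
    exact h
  refine Nat.card_eq_of_bijective φ ⟨?_, ?_⟩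
  · intro x y
    induction x using Quotient.inductionOn' with | h a => ?_
    induction y using Quotient.inductionOn' with | h b => ?_
    intro hab
    have hab' : (QuotientGroup.mk (f a) : P ⧸ H) = QuotientGroup.mk (f b) := hab
    rw [QuotientGroup.eq] at hab'
    change (QuotientGroup.mk a : G ⧸ H.comap f) = QuotientGroup.mk b
    rw [QuotientGroup.eq, Subgroup.mem_comap, map_mul, map_inv]
    exact hab'
  · intro x
    induction x using Quotient.inductionOn' with | h y => ?_
    -- the open coset `y H` meets the dense image of `f`
    have hopen : IsOpen ((fun z => y⁻¹ * z) ⁻¹' (H : Set P)) := hH.preimage (by fun_prop)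
    obtain ⟨g, hg⟩ := hf.exists_mem_open hopen ⟨y, by simp [one_mem]⟩
    refine ⟨QuotientGroup.mk g, ?_⟩
    change (QuotientGroup.mk (f g) : P ⧸ H) = QuotientGroup.mk y
    rw [QuotientGroup.eq, ← inv_mem_iff]
    simpa [mul_inv_rev] using hg

/-- Two subgroups of index `2` containing a common subgroup `A` whose (finite) index is not divisible
by `4` coincide: otherwise `[G : M ⊓ M'] = 4` would divide `[G : A]`. Used for [EtTh] Prop. 2.4:
`Π^tp_X` is the unique index-`2` subgroup of `Π^tp_C` containing `Π^tp_{X̲̲}` (`[Π_C : Π_{X̲̲}] = 2l²`,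
`l` odd). [cite: MochizukiEtTh2009, Prop 2.4 p.38] -/
theorem _root_.Subgroup.eq_of_index_two_of_le {A M M' : Subgroup G} (hM : M.index = 2)
    (hM' : M'.index = 2) (hA : A ≤ M) (hA' : A ≤ M') (h4 : ¬ 4 ∣ A.index) : M = M' := by
  by_contra hne
  haveI : M'.Normal := Subgroup.normal_of_index_eq_two hM'
  have hrel : M'.relIndex M = 2 := by
    have hdvd : M'.relIndex M ∣ 2 := hM' ▸ Subgroup.relIndex_dvd_index_of_normal M' M
    rcases (Nat.dvd_prime Nat.prime_two).mp hdvd with h1 | h2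
    · exfalso
      rw [Subgroup.relIndex_eq_one] at h1
      -- `M ≤ M'` and both have index `2`, so `M = M'`
      apply hne
      refine le_antisymm h1 ?_
      have := Subgroup.relIndex_mul_index h1
      rw [hM, hM'] at this
      have h1' : M.relIndex M' = 1 := by omega
      exact (Subgroup.relIndex_eq_one.mp h1')
    · exact h2
  have hinf : (M ⊓ M').index = 4 := by
    have := Subgroup.relIndex_mul_index (inf_le_left : M ⊓ M' ≤ M)
    rw [inf_comm, Subgroup.inf_relIndex_right, hrel, hM] at this
    rw [inf_comm]
    omega
  exact h4 (hinf ▸ Subgroup.index_dvd_of_le (le_inf hA hA'))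

/-- An automorphism fixing `A` stabilises the unique index-`2` subgroup containing `A` (when
`4 ∤ [G : A]`). [cite: MochizukiEtTh2009, Prop 2.4 p.38] -/
theorem _root_.Subgroup.map_eq_self_of_index_two (e : G ≃* G) {A M : Subgroup G} (hM : M.index = 2)
    (hA : A ≤ M) (h4 : ¬ 4 ∣ A.index) (heA : A.map (e : G →* G) = A) :
    M.map (e : G →* G) = M :=
  Subgroup.eq_of_index_two_of_le (by rw [Subgroup.index_map_equiv]; exact hM) hM
    (heA ▸ Subgroup.map_mono hA) hA h4

end Index

namespace ThetaCovers

namespace TemperedCoverData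

universe u

variable {l : ℕ} (T : TemperedCoverData.{u} l)

/-! ### The tower members are open in `Π^tp_C` -/

/-- `Ker(Δ_X ↠ Δ̄_X) ⊆ Π_{C̲̲}` (the splitting `S` of Def. 2.3 contains it).
[cite: MochizukiEtTh2009, Def 2.3 p.38] -/
theorem barKer_le_PiCuu : T.barKer ≤ T.PiCuu := by
  obtain ⟨H', E, S, ι, -, -, -, -, hS, hEq⟩ := T.isTypeLTorsThetaPm.out
  rw [hEq]
  exact hS.barKer_le.trans (le_sup_left.trans le_sup_left)

/-- `Π_{C̲̲}` is open in `Π_C` — the API form of the interface field `TemperedCoverData.isOpen_PiCuu'`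
(v2 of `ThetaCoversTempered.lean`; formerly derived from `CoverData.isOpen_barKer`, which forces `G_K`
finite — `Sec2TemperedCoverDataFiniteGK.lean`, GAP-LEDGER G-L2d3-5). [cite: MochizukiEtTh2009, Def 2.3 p.38] -/
theorem isOpen_PiCuu : IsOpen (T.PiCuu : Set T.PiC) :=
  T.isOpen_PiCuu'

/-- `Π_{X̲̲} = Π_{C̲̲} ∩ Π_X` is open in `Π_C`. [cite: MochizukiEtTh2009, Def 2.3 p.38] -/
theorem isOpen_PiXuu : IsOpen (T.PiXuu : Set T.PiC) :=
  T.isOpen_PiCuu.inter T.isOpen_PiX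

/-- `Π_{X̲}` is open in `Π_C`. [cite: MochizukiEtTh2009, Def 2.1 p.36] -/
theorem isOpen_PiXu : IsOpen (T.PiXu : Set T.PiC) :=
  Subgroup.isOpen_mono (le_sup_left : T.PiXuu ≤ T.PiXu) T.isOpen_PiXuu

/-! `Π_{C̲}` is open in `Π_C`: `TemperedCoverData.isOpen_PiCu` of `ThetaCoversAutCu.lean` (imported; the
duplicate declaration formerly here was removed in v2 — one fully-qualified name, one module). -/

/-- The tempered fundamental group `Π^tp_Z = toHat⁻¹(Π_Z)` of an open member is open in `Π^tp_C`
(`toHat` is continuous). [cite: MochizukiEtTh2009, Prop 2.4 p.38] -/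
theorem isOpen_tp {H : Subgroup T.PiC} (hH : IsOpen (H : Set T.PiC)) : IsOpen (T.tp H : Set T.Gtp) :=
  hH.preimage T.continuous_toHat

/-! ### Uniqueness of the extension under temp-slimness -/

/-- If `Π^tp_C` is temp-slim then an extension of `γ` (on an open `Π^tp_Z`) to `Π^tp_C` is UNIQUE:
two automorphisms of `Π^tp_C` restricting to `γ` coincide ("induces isomorphisms", Prop. 2.4 — the
canonicity of the induced maps). [cite: MochizukiEtTh2009, Prop 2.4 p.38] -/
theorem extendsStabilising_unique (hslim : IsSlimGroup T.Gtp) {H : Subgroup T.Gtp}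
    (hH : IsOpen (H : Set T.Gtp)) (γ : H ≃ₜ* H) {Γ Γ' : T.Gtp ≃ₜ* T.Gtp}
    (hΓ : ∀ h : H, Γ h = γ h) (hΓ' : ∀ h : H, Γ' h = γ h) : Γ = Γ' :=
  hslim.continuousMulEquiv_eq_of_eqOn hH Γ Γ' fun x hx => by rw [hΓ ⟨x, hx⟩, hΓ' ⟨x, hx⟩]

/-- Under temp-slimness of `Π^tp_C`, `ExtendsStabilising` (existence, as printed) upgrades to unique
existence. [cite: MochizukiEtTh2009, Prop 2.4 p.38] -/
theorem existsUnique_of_extendsStabilising (hslim : IsSlimGroup T.Gtp) {H : Subgroup T.Gtp}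
    (hH : IsOpen (H : Set T.Gtp)) {γ : H ≃ₜ* H} {L : List (Subgroup T.Gtp)}
    (h : T.ExtendsStabilising H γ L) :
    ∃! Γ : T.Gtp ≃ₜ* T.Gtp, (∀ x : H, Γ x = γ x) ∧ ∀ S ∈ L, S.map Γ.toMulEquiv.toMonoidHom = S := by
  obtain ⟨Γ, hΓ, hL⟩ := h
  exact ⟨Γ, ⟨hΓ, hL⟩, fun Γ' hΓ' => T.extendsStabilising_unique hslim hH γ hΓ'.1 hΓ⟩

/-- The members `Π^tp_{X̲̲}, Π^tp_{X̲}, Π^tp_{C̲̲}, Π^tp_{C̲}` of the undotted tower are open in `Π^tp_C`.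
[cite: MochizukiEtTh2009, Prop 2.4 p.38] -/
theorem isOpen_of_mem_four {Z : Subgroup T.Gtp}
    (hZ : Z ∈ [T.tp T.PiXuu, T.tp T.PiXu, T.tp T.PiCuu, T.tp T.PiCu]) : IsOpen (Z : Set T.Gtp) := by
  simp only [List.mem_cons, List.mem_nil_iff, or_false] at hZ
  rcases hZ with rfl | rfl | rfl | rfl
  · exact T.isOpen_tp T.isOpen_PiXuu
  · exact T.isOpen_tp T.isOpen_PiXu
  · exact T.isOpen_tp T.isOpen_PiCuu
  · exact T.isOpen_tp T.isOpen_PiCu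

/-- **Prop. 2.4 with uniqueness** (slim form): if `Π^tp_C` is temp-slim, each clause of `Prop24` holds
with `∃!` in place of `∃` — e.g. case (i): every automorphism of `Π^tp_{X̲̲}` extends UNIQUELY to
`Π^tp_C` stabilising the tower. [cite: MochizukiEtTh2009, Prop 2.4 p.38] -/
theorem prop24_existsUnique (hslim : IsSlimGroup T.Gtp) (h : T.Prop24)
    (γ : ↥(T.tp T.PiXuu) ≃ₜ* ↥(T.tp T.PiXuu)) :
    ∃! Γ : T.Gtp ≃ₜ* T.Gtp, (∀ x : ↥(T.tp T.PiXuu), Γ x = γ x) ∧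
      ∀ S ∈ T.tower, S.map Γ.toMulEquiv.toMonoidHom = S :=
  T.existsUnique_of_extendsStabilising hslim (T.isOpen_tp T.isOpen_PiXuu) (h.1 γ)


/-- Prop. 2.4 (ii) with uniqueness (slim form): automorphisms of `Π^tp_{X̲}`.
[cite: MochizukiEtTh2009, Prop 2.4 p.38] -/
theorem prop24_existsUnique_ii (hslim : IsSlimGroup T.Gtp) (h : T.Prop24)
    (γ : ↥(T.tp T.PiXu) ≃ₜ* ↥(T.tp T.PiXu)) :
    ∃! Γ : T.Gtp ≃ₜ* T.Gtp, (∀ x : ↥(T.tp T.PiXu), Γ x = γ x) ∧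
      ∀ S ∈ [T.tp T.PiXu, T.tp T.PiX, T.PiYddtp], S.map Γ.toMulEquiv.toMonoidHom = S :=
  T.existsUnique_of_extendsStabilising hslim (T.isOpen_tp T.isOpen_PiXu) (h.2.1 γ)

/-- Prop. 2.4 (iii) with uniqueness (slim form): automorphisms of `Π^tp_{C̲̲}`.
[cite: MochizukiEtTh2009, Prop 2.4 p.38] -/
theorem prop24_existsUnique_iii (hslim : IsSlimGroup T.Gtp) (h : T.Prop24)
    (γ : ↥(T.tp T.PiCuu) ≃ₜ* ↥(T.tp T.PiCuu)) :
    ∃! Γ : T.Gtp ≃ₜ* T.Gtp, (∀ x : ↥(T.tp T.PiCuu), Γ x = γ x) ∧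
      ∀ S ∈ T.tower, S.map Γ.toMulEquiv.toMonoidHom = S :=
  T.existsUnique_of_extendsStabilising hslim (T.isOpen_tp T.isOpen_PiCuu) (h.2.2.1 γ)

/-- Prop. 2.4 (iv) with uniqueness (slim form): automorphisms of `Π^tp_{C̲}`.
[cite: MochizukiEtTh2009, Prop 2.4 p.38] -/
theorem prop24_existsUnique_iv (hslim : IsSlimGroup T.Gtp) (h : T.Prop24)
    (γ : ↥(T.tp T.PiCu) ≃ₜ* ↥(T.tp T.PiCu)) :
    ∃! Γ : T.Gtp ≃ₜ* T.Gtp, (∀ x : ↥(T.tp T.PiCu), Γ x = γ x) ∧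
      ∀ S ∈ [T.tp T.PiCu, T.tp T.PiXu, T.tp T.PiX, T.PiYddtp], S.map Γ.toMulEquiv.toMonoidHom = S :=
  T.existsUnique_of_extendsStabilising hslim (T.isOpen_tp T.isOpen_PiCu) (h.2.2.2 γ)

/-- **Prop. 2.6 with uniqueness** (slim form). [cite: MochizukiEtTh2009, Prop 2.6 p.40] -/
theorem prop26_existsUnique (hslim : IsSlimGroup T.Gtp) (h : T.Prop26) {Z : Subgroup T.Gtp}
    (hZ : Z ∈ [T.tp T.PiXuu, T.tp T.PiXu, T.tp T.PiCuu, T.tp T.PiCu])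
    (γ : ↥(Z ⊓ T.PiCdot) ≃ₜ* ↥(Z ⊓ T.PiCdot)) :
    ∃! Γ : T.Gtp ≃ₜ* T.Gtp, (∀ x : ↥(Z ⊓ T.PiCdot), Γ x = γ x) ∧
      ∀ S ∈ [Z ⊓ T.PiCdot, Z, T.PiCdot], S.map Γ.toMulEquiv.toMonoidHom = S :=
  T.existsUnique_of_extendsStabilising hslim ((T.isOpen_of_mem_four hZ).inter T.isOpen_PiCdot)
    (h Z hZ γ)

/-! ### The `X`-clause of Prop. 2.4 (i)/(ii) is automatic -/

/-- `[Π^tp_C : Π^tp_Z] = [Π_C : Π_Z]` for an open member `Π_Z` (dense image of `Π^tp_C` in `Π_C`).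
[cite: MochizukiEtTh2009, Prop 2.4 p.38] -/
theorem index_tp {H : Subgroup T.PiC} (hH : IsOpen (H : Set T.PiC)) : (T.tp H).index = H.index :=
  Subgroup.index_comap_of_denseRange T.toHat T.isProfiniteCompletion_toHat.denseRange H hH

/-- `[Π^tp_C : Π^tp_X] = 2`. [cite: MochizukiEtTh2009, Prop 2.4 p.38] -/
theorem index_tp_PiX : (T.tp T.PiX).index = 2 := by
  rw [T.index_tp T.isOpen_PiX, T.index_PiX]

/-- **The `X`-clause of Prop. 2.4 (i) is group theory**: an automorphism `Γ` of `Π^tp_C` stabilising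
`Π^tp_{X̲̲}` stabilises `Π^tp_X` — provided `4 ∤ [Π_C : Π_{X̲̲}]` (in print `= 2l²`, `l` odd; taken as a
hypothesis on the profinite index), `Π^tp_X` being then the unique index-`2` subgroup of `Π^tp_C`
containing `Π^tp_{X̲̲}`. [cite: MochizukiEtTh2009, Prop 2.4 p.38] -/
theorem map_tp_PiX_eq_of_PiXuu (Γ : T.Gtp ≃ₜ* T.Gtp) (h4 : ¬ 4 ∣ T.PiXuu.index)
    (hΓ : (T.tp T.PiXuu).map Γ.toMulEquiv.toMonoidHom = T.tp T.PiXuu) :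
    (T.tp T.PiX).map Γ.toMulEquiv.toMonoidHom = T.tp T.PiX := by
  have h4' : ¬ 4 ∣ (T.tp T.PiXuu).index := by rwa [T.index_tp T.isOpen_PiXuu]
  exact Subgroup.map_eq_self_of_index_two Γ.toMulEquiv T.index_tp_PiX
    (Subgroup.comap_mono (inf_le_right : T.PiXuu ≤ T.PiX)) h4' hΓ

/-- **The `X`-clause of Prop. 2.4 (ii)**: an automorphism of `Π^tp_C` stabilising `Π^tp_{X̲}` stabilises
`Π^tp_X`, provided `4 ∤ [Π_C : Π_{X̲}]` (in print `= 2l`). [cite: MochizukiEtTh2009, Prop 2.4 p.38] -/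
theorem map_tp_PiX_eq_of_PiXu (Γ : T.Gtp ≃ₜ* T.Gtp) (h4 : ¬ 4 ∣ T.PiXu.index)
    (hΓ : (T.tp T.PiXu).map Γ.toMulEquiv.toMonoidHom = T.tp T.PiXu) :
    (T.tp T.PiX).map Γ.toMulEquiv.toMonoidHom = T.tp T.PiX := by
  have h4' : ¬ 4 ∣ (T.tp T.PiXu).index := by rwa [T.index_tp T.isOpen_PiXu]
  have hle : T.PiXu ≤ T.PiX :=
    sup_le (inf_le_right : T.PiXuu ≤ T.PiX) (T.barTheta_le.trans inf_le_left)
  exact Subgroup.map_eq_self_of_index_two Γ.toMulEquiv T.index_tp_PiX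
    (Subgroup.comap_mono hle) h4' hΓ

end TemperedCoverData

end ThetaCovers

end Literature.AnabelianGeometry.EtaleTheta
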